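import Literature.MathematicalPhysics.QuantumFieldTheory.Balaban1983to89.B13Sect2Statements
import Literature.MathematicalPhysics.QuantumFieldTheory.Dimock2011to13.UrsellTreeGraphBound

/-!
# `Balaban1983to89.B13UrsellKP` — T. Bałaban, *Renormalization group approach to lattice gauge field theories. II.
Cluster expansions*, Commun. Math. Phys. **116** (1988) 1–22 [Balaban1988RG2Cluster]: the *"well-known formula"*
(2.11) ⇒ (2.12) p. 14 — the printed Ursell coefficient `ρ^T` IS the tree's hard-core Ursell coefficient, and the
exponentiation identity order by order in `n`, PROVED

statement-level skeleton of published theorems with citation tags; proofs where landed; nothing here is a claim about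
the Yang–Mills mass gap

PDF held: `paper:balaban1988-cmp116-rg-ii-cluster` (journal page = PDF page + 0); p. 14 read this session (OCR text
`p0014.txt`, prose legible, displays as transcribed from the page renders in `B13MayerDecoupling`); [Cammarota1982] held
`paper:doi-10-1007-bf01403502` (pp. 519, 526 read).

CITATION HEADER / WHAT IS REPRODUCED (cell `lit-balaban`, Phase-2 proof seat p24, SKELETON row **B13.Def2.12** of
`run/shared/lean/pub/lit-balaban/SKELETON.md`; HOME `run/shared/lean/pub/lit-balaban/lit-balaban-p24/`).  The row's
printed objects were typed by r10 in `B13MayerDecoupling` Part D (`connGraphs` = C_n, `rhoT` = ρ^T, `ursellSeries212/213`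
= (2.12)/(2.13) as formal `tsum`s) and the row recorded as ABSENT *"the Mayer identity linking them"* to the tree's kernel
objects.  p. 14, verbatim: *"If the activities H(Z) of the above polymer expansion are sufficiently small, then the
polymer expansion can be exponentiated according to the well-known formula, see [36, 60, 26, 25, 67, 50]. We obtain by
(I.2.13), (1.41), (2.11)* `𝐄^{(k+1)} = Σ_{n=1}^∞ (1/n!) Σ_{(Z₁,…,Z_n)} ρ^T(Z₁,…,Z_n) H(Z₁)⋯H(Z_n),` (2.12) *where ρ^T(Z) = 1,
and* `ρ^T(Z₁,…,Z_n) = Σ_{g∈C_n} Π_{{i,j}∈g} (ζ(Z_i, Z_j) − 1),` *C_n is the set of connected graphs on the set {1,…,n}."*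
([26] = [Cammarota1982], whose (1.17) p. 519 defines the same *"combinatorial function φ^T (truncated function) … where
C_n is the set of the connected graphs on {1,…,n}"* and whose §3, Proposition p. 526, is the tree-graph inequality
*"|φ(f)| ≤ N(f)"*, `N(f)` *"the number of trees contained in f"*.)  This file proves, for every two-body function `ζ`
with the two printed properties used — values in `{0, 1}` and symmetry (hypotheses `h01`, `hsymm`, as in
`B13Sect2Statements.polymerExpansion_211`) — and every finite polymer catalogue `P`:
* Part A — **`rhoT_eq_hcUrsell`**: the printed `ρ^T(Z₁,…,Z_n)` (r10's `rhoT`: lines `i < j`, Mathlib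
  `SimpleGraph.Connected`) EQUALS the tree's Möbius-defined hard-core Ursell coefficient
  `Literature.Probability.LatticeModels.hcUrsell` of the index set for the graph `i ∼ j ⟺ ζ(Z_i,Z_j) = 0` (`idxGraph`),
  through the Dimock lineage's connected-graph sum `Dimock2011to13.UrsellConnectedGraphSum.hcUrsell_eq_sum_graphs`
  (bijection lines ↔ unordered pairs, `connected_iff_isConnColl`); hence **`abs_rhoT_le_pow`**: `|ρ^T(Z₁,…,Z_n)| ≤ n^{n−2}`
  (the tree-graph inequality of [26] §3 + Cayley, tree `UrsellTreeGraphBound.abs_hcUrsell_le_pow`) — the estimate behind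
  p. 20 *"sufficient conditions for convergence of the series (2.12), (2.13) are satisfied, see [26, 67, 25, 50]"*.
* Part B — the *"well-known formula"* (2.11) ⇒ (2.12) ORDER BY ORDER: per sequence **`hardCore_eq_sum_setPartitions_rhoT`**:
  `Π_{i<j} ζ(Z_i,Z_j) = Σ_{π partition of {1,…,n}} Π_{B∈π} ρ^T((Z_i)_{i∈B})` (`subseq`; blocks as index sets:
  `hardCore_eq_sum_setPartitions_hcUrsell`, `hcUrsell_block_eq_rhoT`), and summed over the sequences with the activities,
  **`seqTerm_succ`**: `a_{n+1} = Σ_{k=0}^{n} C(n,k) u_{k+1} a_{n−k}` for `a_n` = the order-`n` term of (2.11)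
  (`B13Sect2Statements.seqTerm`) and `u_n` = the order-`n` term of (2.12) (`ursellTerm`; `ursellSeries212_eq_tsum`), i.e.
  `A′ = U′A`, `A(0) = 1`, `U(0) = 0` for the exponential generating functions — (2.11) `= exp` (2.12) as formal power series.
The ANALYTIC identification under a smallness condition ((2.12) = the Kotecký–Preiss `polymerLogZ`, (2.13) =
`B13Resummation.locE`, i.e. the printed series summed = the tree's truncated weights) is the sibling `B13UrsellKPSeries`.
NOT here: anything of Lemma 3 / (2.38)–(2.41) (`B13Resummation`), the general (soft) two-body functions of [26].
D-0026: no named fact; every `Prop` is a proved `theorem`; the `def`s are printed objects (`idxGraph`, `subseq`,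
`ursellTerm`) or private plumbing.
-/

noncomputable section

namespace Literature.MathematicalPhysics.QuantumFieldTheory.Balaban1983to89.B13UrsellKP

open Finset
open Literature.MathematicalPhysics.QuantumFieldTheory.Balaban1983to89.B13MayerDecoupling (lines graphOf connGraphs
  rhoT rhoT_zero rhoT_one ursellSeries212 ursellSeries213)
open Literature.MathematicalPhysics.QuantumFieldTheory.Balaban1983to89.B13Sect2Statements (hardCore seqTerm
  polymerSeries211)
open Literature.Probability.LatticeModels (hcUrsell edgeFreeInd setPartitions IsSetPartition mem_setPartitions
  IsCompatible isCompatible_iff' sum_setPartitions_prod_hcUrsell sum_hcUrsell_mul_edgeFreeInd hcUrsell_map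
  edgeFreeInd_map)
open Literature.MathematicalPhysics.QuantumFieldTheory.Dimock2011to13.MayerExpansion (IsConnColl Linked)
open Literature.MathematicalPhysics.QuantumFieldTheory.Dimock2011to13.UrsellConnectedGraphSum (edges pairs zetaSubOne
  Adj mk_mem_edges exists_of_mem_edges hcUrsell_eq_sum_graphs)
open Literature.MathematicalPhysics.QuantumFieldTheory.Dimock2011to13.UrsellTreeGraphBound (abs_hcUrsell_le_pow)

variable {P : Type*}

/-! ## Part A. The printed `ρ^T` of (2.12) is the Möbius-defined hard-core Ursell coefficient of the tree -/

/-- The hard-core graph on the INDICES of a sequence `(Z₁,…,Z_n)`: `i ∼ j` iff `ζ(Z_i, Z_j) = 0` (print (2.11) p. 14: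
*"ζ(Z, Z′) = 0 if Z ∩ Z′ contains a cube, or a wall of a cube"*), i.e. iff the factor `ζ(Z_i, Z_j) − 1` of (2.12) is
`−1` rather than `0`. [cite: Balaban1988RG2Cluster, (2.11)–(2.12) p.14] -/
def idxGraph (ζ : P → P → ℝ) {ι : Type*} (Z : ι → P) : ι → ι → Prop := fun i j => ζ (Z i) (Z j) = 0

/-- decidability of the index graph (plumbing). [cite: Balaban1988RG2Cluster, (2.12) p.14] (elementary API for (2.12)) -/
instance idxGraph.instDecidableRel (ζ : P → P → ℝ) {ι : Type*} (Z : ι → P) : DecidableRel (idxGraph ζ Z) :=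
  fun _ _ => by unfold idxGraph; infer_instance

variable {ζ : P → P → ℝ}

/-- The index graph of a symmetric `ζ` is symmetric. [cite: Balaban1988RG2Cluster, (2.12) p.14] (elementary API for (2.12)) -/
theorem idxGraph_symm (hsymm : ∀ Z Z', ζ Z Z' = ζ Z' Z) {ι : Type*} (Z : ι → P) :
    ∀ i j, idxGraph ζ Z i j → idxGraph ζ Z j i := by
  intro i j h
  unfold idxGraph at h ⊢
  rwa [hsymm]

section Graphs

variable {n : ℕ}

/-- an ordered line `(i, j)`, `i < j`, as an unordered pair (plumbing between `B13MayerDecoupling.lines` and the `Sym2`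
edges of the Dimock lineage). [cite: Balaban1988RG2Cluster, (2.12) p.14] (elementary API for (2.12)) -/
private def toSym2 (p : Fin n × Fin n) : Sym2 (Fin n) := s(p.1, p.2)

/-- membership in `lines n` (plumbing). [cite: Balaban1988RG2Cluster, (2.11) p.14] (elementary API for (2.11)) -/
private theorem mem_lines {p : Fin n × Fin n} : p ∈ lines n ↔ p.1 < p.2 := by
  simp [lines]

/-- `toSym2` is injective on the lines (plumbing). [cite: Balaban1988RG2Cluster, (2.12) p.14] (elementary API for (2.12)) -/
private theorem toSym2_injOn : Set.InjOn (toSym2 (n := n)) (lines n : Set (Fin n × Fin n)) := by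
  rintro ⟨a, b⟩ hp ⟨c, d⟩ hq h
  have hp' : a < b := mem_lines.1 (Finset.mem_coe.1 hp)
  have hq' : c < d := mem_lines.1 (Finset.mem_coe.1 hq)
  rcases Sym2.eq_iff.1 h with ⟨h1, h2⟩ | ⟨h1, h2⟩
  · subst h1 h2; rfl
  · subst h1 h2; exact absurd hp' (lt_asymm hq')

/-- adjacency in the `Sym2`-image of a set of lines is the adjacency of `B13MayerDecoupling.graphOf` (plumbing).
[cite: Balaban1988RG2Cluster, (2.12) p.14] (elementary API for (2.12)) -/
private theorem adj_image_iff {g : Finset (Fin n × Fin n)} (hg : g ⊆ lines n) (i j : Fin n) :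
    Adj (g.image toSym2) i j ↔ (graphOf g).Adj i j := by
  rw [graphOf, SimpleGraph.fromRel_adj]
  simp only [Adj, Finset.mem_image]
  constructor
  · rintro ⟨⟨a, b⟩, hp, hpe⟩
    have hlt : a < b := mem_lines.1 (hg hp)
    rcases Sym2.eq_iff.1 hpe with ⟨h1, h2⟩ | ⟨h1, h2⟩
    · subst h1 h2; exact ⟨ne_of_lt hlt, Or.inl hp⟩
    · subst h1 h2; exact ⟨(ne_of_lt hlt).symm, Or.inr hp⟩
  · rintro ⟨-, h | h⟩
    · exact ⟨(i, j), h, rfl⟩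
    · exact ⟨(j, i), h, Sym2.eq_swap⟩

/-- monotonicity of the reflexive-transitive closure in the relation (plumbing).
[cite: Balaban1988RG2Cluster, (2.12) p.14] (elementary API for (2.12)) -/
private theorem rtg_mono {α : Type*} {r p : α → α → Prop} (hrp : ∀ a b, r a b → p a b) {a b : α}
    (h : Relation.ReflTransGen r a b) : Relation.ReflTransGen p a b := by
  induction h with
  | refl => exact Relation.ReflTransGen.refl
  | tail _ hbc ih => exact ih.tail (hrp _ _ hbc)

/-- `B13MayerDecoupling`'s connectedness (Mathlib `SimpleGraph.Connected` of `graphOf g`) is the Dimock lineage's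
`IsConnColl` of the `Sym2`-image on the full index set (plumbing). [cite: Balaban1988RG2Cluster, (2.12) p.14]
(elementary API for (2.12)) -/
private theorem connected_iff_isConnColl {g : Finset (Fin n × Fin n)} (hg : g ⊆ lines n) :
    (graphOf g).Connected ↔ IsConnColl (Adj (g.image toSym2)) (Finset.univ : Finset (Fin n)) := by
  rw [SimpleGraph.connected_iff, IsConnColl]
  have key : ∀ i j, (graphOf g).Reachable i j ↔ Linked (Adj (g.image toSym2)) Finset.univ i j := by
    intro i j
    rw [SimpleGraph.reachable_iff_reflTransGen, Linked]
    constructor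
    · exact fun h => rtg_mono
        (fun a b hab => ⟨Finset.mem_univ _, Finset.mem_univ _, (adj_image_iff hg a b).2 hab⟩) h
    · exact fun h => rtg_mono (fun a b hab => (adj_image_iff hg a b).1 hab.2.2) h
  constructor
  · rintro ⟨hpre, hne⟩
    exact ⟨Finset.univ_nonempty_iff.2 hne, fun i _ j _ => (key i j).1 (hpre i j)⟩
  · rintro ⟨hne, h⟩
    exact ⟨fun i j => (key i j).2 (h i (Finset.mem_univ _) j (Finset.mem_univ _)),
      Finset.univ_nonempty_iff.1 hne⟩

/-- every set of unordered pairs of distinct indices is the image of a set of lines (plumbing).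
[cite: Balaban1988RG2Cluster, (2.12) p.14] (elementary API for (2.12)) -/
private theorem image_filter_toSym2 {G : Finset (Sym2 (Fin n))} (hG : G ⊆ pairs (Finset.univ : Finset (Fin n))) :
    ((lines n).filter fun p => toSym2 p ∈ G).image toSym2 = G := by
  ext e
  simp only [Finset.mem_image, Finset.mem_filter]
  constructor
  · rintro ⟨p, ⟨-, hp⟩, rfl⟩; exact hp
  · intro he
    obtain ⟨a, b, rfl, -, -, hne, -⟩ := exists_of_mem_edges (hG he)
    rcases lt_or_gt_of_ne hne with h | h
    · exact ⟨(a, b), ⟨mem_lines.2 h, he⟩, rfl⟩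
    · refine ⟨(b, a), ⟨mem_lines.2 h, ?_⟩, Sym2.eq_swap⟩
      show s(b, a) ∈ G
      rwa [Sym2.eq_swap]

open Classical in
/-- **The printed `ρ^T` of (2.12) IS the tree's hard-core Ursell coefficient.**  For a two-body function `ζ` with
values in `{0, 1}` and symmetric (the printed hard core of (2.11)), every `n ≥ 1` and every sequence `(Z₁,…,Z_n)`:
`ρ^T(Z₁,…,Z_n) = Σ_{g∈C_n} Π_{{i,j}∈g} (ζ(Z_i,Z_j) − 1)` (`B13MayerDecoupling.rhoT`, lines `i < j`, Mathlib connectedness)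
equals `Literature.Probability.LatticeModels.hcUrsell` of the index set `{1,…,n}` for the graph `i ∼ j ⟺ ζ(Z_i,Z_j) = 0`
— the coefficient DEFINED in the tree by Möbius inversion of `Σ_π Π_{B∈π} c(B) = 𝟙[no edge]`; via the Dimock lineage's
`UrsellConnectedGraphSum.hcUrsell_eq_sum_graphs` (connected-graph sum over `Sym2` edge sets) and the bijection lines ↔
unordered pairs.  Print p. 14: *"ρ^T(Z₁,…,Z_n) = Σ_{g∈C_n} Π_{{i,j}∈g} (ζ(Z_i, Z_j) − 1), C_n is the set of connected
graphs on the set {1,…,n}"*. [cite: Balaban1988RG2Cluster, (2.12) p.14] -/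
theorem rhoT_eq_hcUrsell (h01 : ∀ Z Z', ζ Z Z' = 0 ∨ ζ Z Z' = 1) (hsymm : ∀ Z Z', ζ Z Z' = ζ Z' Z)
    {n : ℕ} (hn : 0 < n) (Z : Fin n → P) :
    rhoT ζ Z = (hcUrsell (idxGraph ζ Z) (Finset.univ : Finset (Fin n)) : ℝ) := by
  have hne : (Finset.univ : Finset (Fin n)).Nonempty := Finset.univ_nonempty_iff.2 ⟨⟨0, hn⟩⟩
  rw [hcUrsell_eq_sum_graphs (idxGraph_symm hsymm Z) hne, Int.cast_sum]
  unfold rhoT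
  refine Finset.sum_nbij' (fun g => g.image toSym2) (fun G => (lines n).filter fun p => toSym2 p ∈ G)
    ?_ ?_ ?_ ?_ ?_
  · -- into the connected `Sym2` edge sets
    intro g hg
    rw [connGraphs, Finset.mem_filter, Finset.mem_powerset] at hg
    rw [Finset.mem_filter, Finset.mem_powerset]
    refine ⟨fun e he => ?_, (connected_iff_isConnColl hg.1).1 hg.2⟩
    obtain ⟨p, hp, rfl⟩ := Finset.mem_image.1 he
    exact (mk_mem_edges (H := fun _ _ : Fin n => True) (fun _ _ _ => trivial)).2
      ⟨Finset.mem_univ _, Finset.mem_univ _, ne_of_lt (mem_lines.1 (hg.1 hp)), trivial⟩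
  · -- back to the connected sets of lines
    intro G hG
    rw [Finset.mem_filter, Finset.mem_powerset] at hG
    rw [connGraphs, Finset.mem_filter, Finset.mem_powerset]
    refine ⟨Finset.filter_subset _ _, ?_⟩
    rw [connected_iff_isConnColl (Finset.filter_subset _ _), image_filter_toSym2 hG.1]
    exact hG.2
  · -- left inverse
    intro g hg
    rw [connGraphs, Finset.mem_filter, Finset.mem_powerset] at hg
    ext p
    simp only [Finset.mem_filter, Finset.mem_image]
    constructor
    · rintro ⟨hp, q, hq, hqp⟩
      obtain rfl := toSym2_injOn (Finset.mem_coe.2 (hg.1 hq)) (Finset.mem_coe.2 hp) hqp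
      exact hq
    · exact fun hp => ⟨hg.1 hp, p, hp, rfl⟩
  · -- right inverse
    intro G hG
    rw [Finset.mem_filter, Finset.mem_powerset] at hG
    exact image_filter_toSym2 hG.1
  · -- the weights `Π (ζ − 1)` agree
    intro g hg
    rw [connGraphs, Finset.mem_filter, Finset.mem_powerset] at hg
    rw [Int.cast_prod, Finset.prod_image (toSym2_injOn.mono (Finset.coe_subset.2 hg.1))]
    refine Finset.prod_congr rfl fun p hp => ?_
    have hlt : p.1 < p.2 := mem_lines.1 (hg.1 hp)
    unfold zetaSubOne
    by_cases h0 : ζ (Z p.1) (Z p.2) = 0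
    · have hmem : toSym2 p ∈ edges (idxGraph ζ Z) Finset.univ :=
        (mk_mem_edges (idxGraph_symm hsymm Z)).2 ⟨Finset.mem_univ _, Finset.mem_univ _, ne_of_lt hlt, h0⟩
      rw [if_pos hmem, h0]
      norm_num
    · have h1 : ζ (Z p.1) (Z p.2) = 1 := (h01 _ _).resolve_left h0
      have hmem : toSym2 p ∉ edges (idxGraph ζ Z) Finset.univ :=
        fun h => h0 ((mk_mem_edges (idxGraph_symm hsymm Z)).1 h).2.2.2
      rw [if_neg hmem, h1]
      norm_num

/-- **The tree-graph bound for the printed `ρ^T`** — the estimate for which the paper cites [26] = [Cammarota1982]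
(Thm 1 there; hard-core case: `|Σ_{g∈C_n} Π(ζ−1)| ≤` the number of spanning trees of the graph `{ζ = 0}` `≤ n^{n−2}`,
Cayley): for `ζ ∈ {0,1}` symmetric and `n ≥ 1`, `|ρ^T(Z₁,…,Z_n)| ≤ n^{n−2}`; from `rhoT_eq_hcUrsell` and the Dimock
lineage's `UrsellTreeGraphBound.abs_hcUrsell_le_pow`.  Print p. 20: *"sufficient conditions for convergence of the series
(2.12), (2.13) are satisfied, see [26, 67, 25, 50]"*. [cite: Balaban1988RG2Cluster, (2.12) p.14] -/
theorem abs_rhoT_le_pow (h01 : ∀ Z Z', ζ Z Z' = 0 ∨ ζ Z Z' = 1) (hsymm : ∀ Z Z', ζ Z Z' = ζ Z' Z)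
    {n : ℕ} (hn : 0 < n) (Z : Fin n → P) : |rhoT ζ Z| ≤ (n : ℝ) ^ (n - 2) := by
  have hne : (Finset.univ : Finset (Fin n)).Nonempty := Finset.univ_nonempty_iff.2 ⟨⟨0, hn⟩⟩
  rw [rhoT_eq_hcUrsell h01 hsymm hn Z]
  have h := abs_hcUrsell_le_pow (idxGraph_symm hsymm Z) (Finset.univ : Finset (Fin n)) hne
  rw [Finset.card_univ, Fintype.card_fin] at h
  exact_mod_cast h

end Graphs

/-! ## Part B. The *"well-known formula"* (2.11) ⇒ (2.12): `Π_{i<j} ζ = Σ_{partitions} Π_{blocks} ρ^T`, per sequence and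
summed (the exponential formula order by order in `n`) -/

section PerSequence

variable {n : ℕ}

/-- The hard core `Π_{i<j} ζ(Z_i, Z_j)` of (2.11) is the indicator that the index graph has no edge (the tree's
`edgeFreeInd`), for `ζ ∈ {0,1}` symmetric. [cite: Balaban1988RG2Cluster, (2.11) p.14] -/
theorem hardCore_eq_edgeFreeInd (h01 : ∀ Z Z', ζ Z Z' = 0 ∨ ζ Z Z' = 1) (hsymm : ∀ Z Z', ζ Z Z' = ζ Z' Z)
    (Z : Fin n → P) : hardCore ζ Z = (edgeFreeInd (idxGraph ζ Z) (Finset.univ : Finset (Fin n)) : ℝ) := by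
  unfold hardCore edgeFreeInd
  by_cases hc : IsCompatible (idxGraph ζ Z) (Finset.univ : Finset (Fin n))
  · rw [if_pos hc, Int.cast_one]
    refine Finset.prod_eq_one fun p hp => ?_
    have hlt : p.1 < p.2 := mem_lines.1 hp
    have h0 : ¬ ζ (Z p.1) (Z p.2) = 0 :=
      (isCompatible_iff' _ _).1 hc p.1 (Finset.mem_univ _) p.2 (Finset.mem_univ _) (ne_of_lt hlt)
    exact (h01 _ _).resolve_left h0
  · rw [if_neg hc, Int.cast_zero]
    rw [isCompatible_iff'] at hc
    push Not at hc
    obtain ⟨i, -, j, -, hij, h0⟩ := hc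
    have h0' : ζ (Z i) (Z j) = 0 := h0
    rcases lt_or_gt_of_ne hij with h | h
    · exact Finset.prod_eq_zero (i := (i, j)) (mem_lines.2 h) h0'
    · exact Finset.prod_eq_zero (i := (j, i)) (mem_lines.2 h) (by rw [hsymm]; exact h0')

/-- **(2.11) ⇒ (2.12), per sequence, blocks as index sets**: `Π_{i<j} ζ(Z_i,Z_j) = Σ_{π partition of {1,…,n}}
Π_{B∈π} c(B)`, `c(B)` the hard-core Ursell coefficient of the block `B` of indices (the tree's defining identity
`sum_setPartitions_prod_hcUrsell` read through `hardCore_eq_edgeFreeInd`). [cite: Balaban1988RG2Cluster, (2.12) p.14] -/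
theorem hardCore_eq_sum_setPartitions_hcUrsell (h01 : ∀ Z Z', ζ Z Z' = 0 ∨ ζ Z Z' = 1)
    (hsymm : ∀ Z Z', ζ Z Z' = ζ Z' Z) (Z : Fin n → P) :
    hardCore ζ Z = ∑ π ∈ setPartitions (Finset.univ : Finset (Fin n)),
      ∏ B ∈ π, (hcUrsell (idxGraph ζ Z) B : ℝ) := by
  rw [hardCore_eq_edgeFreeInd h01 hsymm Z, ← sum_setPartitions_prod_hcUrsell]
  push_cast
  rfl

/-- The sub-sequence `(Z_i)_{i∈B}` of `(Z₁,…,Z_n)` indexed by a set `B` of indices, in increasing order (print: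
*"Z₁,…,Z_n"* restricted to a block of a partition of `{1,…,n}`). [cite: Balaban1988RG2Cluster, (2.12) p.14] -/
def subseq (Z : Fin n → P) (B : Finset (Fin n)) : Fin B.card → P := Z ∘ B.orderEmbOfFin rfl

/-- The Ursell coefficient of a block of indices is the printed `ρ^T` of the corresponding sub-sequence (relabelling
invariance, `hcUrsell_map`, + Part A). [cite: Balaban1988RG2Cluster, (2.12) p.14] -/
theorem hcUrsell_block_eq_rhoT (h01 : ∀ Z Z', ζ Z Z' = 0 ∨ ζ Z Z' = 1) (hsymm : ∀ Z Z', ζ Z Z' = ζ Z' Z)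
    (Z : Fin n → P) {B : Finset (Fin n)} (hB : B.Nonempty) :
    (hcUrsell (idxGraph ζ Z) B : ℝ) = rhoT ζ (subseq Z B) := by
  rw [rhoT_eq_hcUrsell h01 hsymm (Finset.card_pos.2 hB)]
  have hmap : (Finset.univ : Finset (Fin B.card)).map (B.orderEmbOfFin rfl).toEmbedding = B := by
    rw [Finset.map_eq_image]
    exact Finset.image_orderEmbOfFin_univ B rfl
  conv_lhs => rw [← hmap]
  rw [hcUrsell_map (B.orderEmbOfFin rfl).toEmbedding (H := idxGraph ζ (subseq Z B)) (H' := idxGraph ζ Z)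
    (fun a b => Iff.rfl)]

/-- **(2.11) ⇒ (2.12), per sequence — the mechanism of the *"well-known formula"* p. 14**: for `ζ ∈ {0,1}` symmetric
and every sequence `(Z₁,…,Z_n)`,
`Π_{{i,j}, i<j} ζ(Z_i, Z_j) = Σ_{π partition of {1,…,n}} Π_{B∈π} ρ^T((Z_i)_{i∈B})`
(grouping the graphs of `Π(1 + (ζ−1))` by connected components); summing over the sequences with `H(Z₁)⋯H(Z_n)/n!`
turns (2.11) into `exp` of (2.12) (`seqTerm_succ` below is the coefficient form).  The same identity is Dimock's
(sunset) [Dimock2013, App. B]. [cite: Balaban1988RG2Cluster, (2.12) p.14] -/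
theorem hardCore_eq_sum_setPartitions_rhoT (h01 : ∀ Z Z', ζ Z Z' = 0 ∨ ζ Z Z' = 1)
    (hsymm : ∀ Z Z', ζ Z Z' = ζ Z' Z) (Z : Fin n → P) :
    hardCore ζ Z = ∑ π ∈ setPartitions (Finset.univ : Finset (Fin n)), ∏ B ∈ π, rhoT ζ (subseq Z B) := by
  rw [hardCore_eq_sum_setPartitions_hcUrsell h01 hsymm Z]
  refine Finset.sum_congr rfl fun π hπ => Finset.prod_congr rfl fun B hB => ?_
  exact hcUrsell_block_eq_rhoT h01 hsymm Z ((mem_setPartitions.1 hπ).nonempty_of_mem hB)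

end PerSequence

section Summed

variable [Fintype P]

/-- The order-`n` term of (2.12) p. 14 before the factor `1/n!`: `Σ_{(Z₁,…,Z_n)} ρ^T(Z₁,…,Z_n) H(Z₁)⋯H(Z_n)` over all
sequences of polymers of the finite catalogue `P` (the summand of `B13MayerDecoupling.ursellSeries212`; companion of
`B13Sect2Statements.seqTerm`, the order-`n` term of (2.11)). [cite: Balaban1988RG2Cluster, (2.12) p.14] -/
def ursellTerm (ζ : P → P → ℝ) (H : P → ℂ) (n : ℕ) : ℂ :=
  ∑ Z : Fin n → P, ((rhoT ζ Z : ℝ) : ℂ) * ∏ i, H (Z i)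

/-- (2.12) AS PRINTED is the series `Σ_n (1/n!) · ursellTerm n` (definitional unfolding of
`B13MayerDecoupling.ursellSeries212`). [cite: Balaban1988RG2Cluster, (2.12) p.14] -/
theorem ursellSeries212_eq_tsum (ζ : P → P → ℝ) (H : P → ℂ) :
    ursellSeries212 ζ H = ∑' n : ℕ, ((n.factorial : ℂ)⁻¹ * ursellTerm ζ H n) := rfl

/-- The series (2.12) has no `n = 0` term (`B13MayerDecoupling.rhoT_zero`). [cite: Balaban1988RG2Cluster, (2.12) p.14] -/
theorem ursellTerm_zero (ζ : P → P → ℝ) (H : P → ℂ) : ursellTerm ζ H 0 = 0 := by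
  simp [ursellTerm, rhoT_zero]

/-- The Ursell sum over sequences indexed by an arbitrary finite index type (plumbing for relabelling: the blocks of a
partition of `{1,…,n}` are not initial segments). [cite: Balaban1988RG2Cluster, (2.12) p.14] (elementary API for (2.12)) -/
private def uGen (ζ : P → P → ℝ) (H : P → ℂ) (ι : Type*) [Fintype ι] [DecidableEq ι] : ℂ :=
  ∑ Z : ι → P, ((hcUrsell (idxGraph ζ Z) (Finset.univ : Finset ι) : ℤ) : ℂ) * ∏ i, H (Z i)

/-- The hard-core sum over sequences indexed by an arbitrary finite index type (plumbing).
[cite: Balaban1988RG2Cluster, (2.11) p.14] (elementary API for (2.11)) -/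
private def aGen (ζ : P → P → ℝ) (H : P → ℂ) (ι : Type*) [Fintype ι] [DecidableEq ι] : ℂ :=
  ∑ Z : ι → P, ((edgeFreeInd (idxGraph ζ Z) (Finset.univ : Finset ι) : ℤ) : ℂ) * ∏ i, H (Z i)

omit [Fintype P] in
/-- relabelling the indices along an equivalence does not change the index graph (plumbing).
[cite: Balaban1988RG2Cluster, (2.12) p.14] (elementary API for (2.12)) -/
private theorem idxGraph_comp_iff {ι κ : Type*} (e : ι ≃ κ) (Z : ι → P) (a b : ι) :
    idxGraph ζ (Z ∘ e.symm) (e a) (e b) ↔ idxGraph ζ Z a b := by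
  simp [idxGraph]

/-- `uGen` is invariant under relabelling (plumbing). [cite: Balaban1988RG2Cluster, (2.12) p.14] (elementary API for (2.12)) -/
private theorem uGen_equiv (H : P → ℂ) {ι κ : Type*} [Fintype ι] [DecidableEq ι] [Fintype κ] [DecidableEq κ]
    (e : ι ≃ κ) : uGen ζ H ι = uGen ζ H κ := by
  unfold uGen
  refine Fintype.sum_equiv (e.arrowCongr (Equiv.refl P)) _ _ fun Z => ?_
  have hZ : (e.arrowCongr (Equiv.refl P)) Z = Z ∘ e.symm := rfl
  rw [hZ]
  congr 1
  · have hmap : (Finset.univ : Finset κ) = (Finset.univ : Finset ι).map e.toEmbedding :=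
      (Finset.map_univ_equiv e).symm
    rw [hmap, hcUrsell_map e.toEmbedding (H := idxGraph ζ Z) (H' := idxGraph ζ (Z ∘ e.symm))
      (fun a b => idxGraph_comp_iff e Z a b)]
  · exact Fintype.prod_equiv e _ _ fun i => by simp

/-- `aGen` is invariant under relabelling (plumbing). [cite: Balaban1988RG2Cluster, (2.11) p.14] (elementary API for (2.11)) -/
private theorem aGen_equiv (H : P → ℂ) {ι κ : Type*} [Fintype ι] [DecidableEq ι] [Fintype κ] [DecidableEq κ]
    (e : ι ≃ κ) : aGen ζ H ι = aGen ζ H κ := by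
  unfold aGen
  refine Fintype.sum_equiv (e.arrowCongr (Equiv.refl P)) _ _ fun Z => ?_
  have hZ : (e.arrowCongr (Equiv.refl P)) Z = Z ∘ e.symm := rfl
  rw [hZ]
  congr 1
  · have hmap : (Finset.univ : Finset κ) = (Finset.univ : Finset ι).map e.toEmbedding :=
      (Finset.map_univ_equiv e).symm
    rw [hmap, edgeFreeInd_map e.toEmbedding (H := idxGraph ζ Z) (H' := idxGraph ζ (Z ∘ e.symm))
      (fun a b => idxGraph_comp_iff e Z a b)]
  · exact Fintype.prod_equiv e _ _ fun i => by simp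

/-- `uGen` on `Fin n`, `n ≥ 1`, is the order-`n` Ursell term (Part A). [cite: Balaban1988RG2Cluster, (2.12) p.14]
(elementary API for (2.12)) -/
private theorem uGen_fin (h01 : ∀ Z Z', ζ Z Z' = 0 ∨ ζ Z Z' = 1) (hsymm : ∀ Z Z', ζ Z Z' = ζ Z' Z) (H : P → ℂ)
    {n : ℕ} (hn : 0 < n) : uGen ζ H (Fin n) = ursellTerm ζ H n := by
  unfold uGen ursellTerm
  refine Fintype.sum_congr _ _ fun Z => ?_
  rw [rhoT_eq_hcUrsell h01 hsymm hn Z]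
  push_cast
  rfl

/-- `aGen` on `Fin n` is the order-`n` hard-core term of (2.11). [cite: Balaban1988RG2Cluster, (2.11) p.14]
(elementary API for (2.11)) -/
private theorem aGen_fin (h01 : ∀ Z Z', ζ Z Z' = 0 ∨ ζ Z Z' = 1) (hsymm : ∀ Z Z', ζ Z Z' = ζ Z' Z) (H : P → ℂ)
    (n : ℕ) : aGen ζ H (Fin n) = seqTerm ζ H n := by
  unfold aGen seqTerm
  refine Fintype.sum_congr _ _ fun Z => ?_
  rw [hardCore_eq_edgeFreeInd h01 hsymm Z]
  push_cast
  rfl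

/-- The factorisation of the sequence sum once the block `S ∋ 1` of the first index is split off: sequences on `{1,…,n+1}`
are pairs (sequence on `S`, sequence on `Sᶜ`) (plumbing). [cite: Balaban1988RG2Cluster, (2.12) p.14]
(elementary API for (2.12)) -/
private theorem sum_split (H : P → ℂ) {m : ℕ} (S : Finset (Fin m)) :
    ∑ Z : Fin m → P, (((hcUrsell (idxGraph ζ Z) S : ℤ) : ℂ) * ∏ i ∈ S, H (Z i)) *
        (((edgeFreeInd (idxGraph ζ Z) (Finset.univ \ S) : ℤ) : ℂ) * ∏ i ∈ Sᶜ, H (Z i))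
      = uGen ζ H {i // i ∈ S} * aGen ζ H {i // i ∉ S} := by
  unfold uGen aGen
  rw [Finset.sum_mul_sum, ← Fintype.sum_prod_type']
  refine Fintype.sum_equiv (Equiv.piEquivPiSubtypeProd (fun i => i ∈ S) (fun _ => P)) _ _ fun Z => ?_
  have e1 : hcUrsell (idxGraph ζ Z) S = hcUrsell (idxGraph ζ (fun a : {i // i ∈ S} => Z a)) Finset.univ := by
    have hm : (Finset.univ : Finset {i // i ∈ S}).map (Function.Embedding.subtype (· ∈ S)) = S := by
      rw [Finset.univ_eq_attach, Finset.attach_map_val]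
    conv_lhs => rw [← hm]
    exact hcUrsell_map (Function.Embedding.subtype (· ∈ S)) (fun a b => Iff.rfl) _
  have e2 : edgeFreeInd (idxGraph ζ Z) (Finset.univ \ S)
      = edgeFreeInd (idxGraph ζ (fun b : {i // i ∉ S} => Z b)) Finset.univ := by
    have hm : (Finset.univ : Finset {i // i ∉ S}).map (Function.Embedding.subtype (· ∉ S)) = Finset.univ \ S := by
      rw [← Finset.subtype_univ, Finset.subtype_map]
      ext i
      simp
    conv_lhs => rw [← hm]
    exact edgeFreeInd_map (Function.Embedding.subtype (· ∉ S)) (fun a b => Iff.rfl) _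
  have e3 : ∏ i ∈ S, H (Z i) = ∏ a : {i // i ∈ S}, H (Z a) := (Finset.prod_coe_sort S (fun i => H (Z i))).symm
  have e4 : ∏ i ∈ Sᶜ, H (Z i) = ∏ b : {i // i ∉ S}, H (Z b) := Finset.prod_subtype _ (by simp) _
  rw [e1, e2, e3, e4]
  rfl

/-- **The exponential formula (2.11) ⇒ (2.12), order by order in `n`** (the coefficient identity behind *"the polymer
expansion can be exponentiated according to the well-known formula"*, p. 14): writing `a_n = Σ_{(Z₁..Z_n)} Π_{i<j}ζ
Π H(Z_i)` (`seqTerm`, (2.11)) and `u_n = Σ_{(Z₁..Z_n)} ρ^T Π H(Z_i)` (`ursellTerm`, (2.12)),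
`a_{n+1} = Σ_{k=0}^{n} C(n,k) u_{k+1} a_{n−k}` — i.e. `A′ = U′·A` for the exponential generating functions
`A = Σ a_n t^n/n! = (2.11)`, `U = Σ u_n t^n/n! = (2.12)`, which with `a_0 = 1`, `u_0 = 0` is `A = exp U` as formal power
series.  Proof: `hardCore_eq_sum_setPartitions_hcUrsell`, split off the block containing the first index
(`sum_hcUrsell_mul_edgeFreeInd`), factorise the sequence sum (`sum_split`) and count the blocks of each size.
[cite: Balaban1988RG2Cluster, (2.12) p.14] -/
theorem seqTerm_succ (h01 : ∀ Z Z', ζ Z Z' = 0 ∨ ζ Z Z' = 1) (hsymm : ∀ Z Z', ζ Z Z' = ζ Z' Z) (H : P → ℂ)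
    (n : ℕ) :
    seqTerm ζ H (n + 1) = ∑ k ∈ Finset.range (n + 1),
      (n.choose k : ℂ) * ursellTerm ζ H (k + 1) * seqTerm ζ H (n - k) := by
  classical
  set 𝒮 : Finset (Finset (Fin (n + 1))) :=
    (Finset.univ : Finset (Fin (n + 1))).powerset.filter (fun S => (0 : Fin (n + 1)) ∈ S) with h𝒮
  -- Step 1: split off the block of the first index, per sequence
  have step1 : seqTerm ζ H (n + 1) = ∑ S ∈ 𝒮,
      ∑ Z : Fin (n + 1) → P, (((hcUrsell (idxGraph ζ Z) S : ℤ) : ℂ) * ∏ i ∈ S, H (Z i)) *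
        (((edgeFreeInd (idxGraph ζ Z) (Finset.univ \ S) : ℤ) : ℂ) * ∏ i ∈ Sᶜ, H (Z i)) := by
    rw [← aGen_fin h01 hsymm H (n + 1), aGen, Finset.sum_comm]
    refine Fintype.sum_congr _ _ fun Z => ?_
    rw [← sum_hcUrsell_mul_edgeFreeInd (H := idxGraph ζ Z) (Finset.mem_univ (0 : Fin (n + 1)))]
    push_cast
    rw [Finset.sum_mul]
    refine Finset.sum_congr rfl fun S _ => ?_
    rw [← Finset.prod_mul_prod_compl S (fun i => H (Z i))]
    ring
  -- Step 2: the sequence sum factorises and each factor is relabelled to an initial segment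
  have step2 : ∀ S ∈ 𝒮,
      ∑ Z : Fin (n + 1) → P, (((hcUrsell (idxGraph ζ Z) S : ℤ) : ℂ) * ∏ i ∈ S, H (Z i)) *
        (((edgeFreeInd (idxGraph ζ Z) (Finset.univ \ S) : ℤ) : ℂ) * ∏ i ∈ Sᶜ, H (Z i))
        = ursellTerm ζ H S.card * seqTerm ζ H (n + 1 - S.card) := by
    intro S hS
    have h0S : (0 : Fin (n + 1)) ∈ S := (Finset.mem_filter.1 hS).2
    have hcard : Fintype.card {i // i ∉ S} = n + 1 - S.card := by
      rw [Fintype.card_subtype_compl, Fintype.card_fin, Fintype.card_coe]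
    rw [sum_split H S, uGen_equiv H S.equivFin, aGen_equiv H (Fintype.equivFinOfCardEq hcard),
      uGen_fin h01 hsymm H (Finset.card_pos.2 ⟨0, h0S⟩), aGen_fin h01 hsymm H]
  -- Step 3: count the blocks `S ∋ 1` of each size
  have step3 : ∑ S ∈ 𝒮, ursellTerm ζ H S.card * seqTerm ζ H (n + 1 - S.card)
      = ∑ T ∈ ((Finset.univ : Finset (Fin (n + 1))).erase 0).powerset,
          ursellTerm ζ H (T.card + 1) * seqTerm ζ H (n - T.card) := by
    refine Finset.sum_nbij' (fun S => S.erase 0) (fun T => insert 0 T) ?_ ?_ ?_ ?_ ?_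
    · intro S _
      exact Finset.mem_powerset.2 (Finset.erase_subset_erase _ (Finset.subset_univ _))
    · intro T _
      exact Finset.mem_filter.2 ⟨Finset.mem_powerset.2 (Finset.subset_univ _), Finset.mem_insert_self _ _⟩
    · intro S hS
      exact Finset.insert_erase (Finset.mem_filter.1 hS).2
    · intro T hT
      have h0 : (0 : Fin (n + 1)) ∉ T := fun h => by simpa using Finset.mem_powerset.1 hT h
      exact Finset.erase_insert h0
    · intro S hS
      have h0 := (Finset.mem_filter.1 hS).2
      have hc : (S.erase 0).card + 1 = S.card := Finset.card_erase_add_one h0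
      have hle : S.card ≤ n + 1 := by
        simpa using Finset.card_le_card (Finset.subset_univ S)
      rw [hc]
      congr 2
      omega
  rw [step1, Finset.sum_congr rfl step2, step3,
    Finset.sum_powerset_apply_card (fun m => ursellTerm ζ H (m + 1) * seqTerm ζ H (n - m)),
    Finset.card_erase_of_mem (Finset.mem_univ _), Finset.card_univ, Fintype.card_fin, Nat.add_sub_cancel]
  refine Finset.sum_congr rfl fun k _ => ?_
  rw [nsmul_eq_mul]
  ring

end Summed

end Literature.MathematicalPhysics.QuantumFieldTheory.Balaban1983to89.B13UrsellKP
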